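import Mathlib
import HarnessLib
import Summits.ResolutionOfSingularities.ResolutionOfSingularities.Theorems.HomologicalConductorPersistenceMonomialCurveExact

/-!
# The cohomology annihilator of a monomial branch as an explicit MONOMIAL IDEAL:
# `ca(k[t][z]/(zᵐ − εᵐtⁿ)) = (z̄ⁱ t̄ᴹ : i < m, (m−1)(n−1) ≤ ni + mM)`

Route `ResolutionOfSingularities/HomologicalConductor`, chain W4.4b, rung S-2 `PersistenceSurface`
(stmt-ResolutionOfSingularities-19970), curve-exact cell (res-L1-w44b-lead-1 WAVE-3 19:45:17Z «stub-2 → keep recurrence /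
curve-exact cells»); seat res-L1-w44b-stub-2 (gen 5).  [OURS · L1 w44b; AI-written, weaker than expert review; NOT a
statement of the manuscript under study (Hironaka 2017), and no statement of that manuscript is used.]

`…PersistenceMonomialCurveExact` (p562244) decides membership: `r ∈ ca(R) ↔ τ^{(m−1)(n−1)} ∣ φ(r)` for
`R = k[t][z]/(zᵐ − εᵐtⁿ)` (`ε ≠ 0`, coprime `m, n > 1`).  The census seats quote centres as IDEALS («`ca(E₆) = (z², zt, t²)`»,
S2-BRIEF R4 / tri-1 CA-CURVE).  This file turns the criterion into the ideal statement:

* `exists_mk_eq_of_natDegree_lt` — normal form: every `r` is `mk g` with `deg_z g < m`;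
* `coeff_lift_mk` — for such `g`, the coefficient of `τ^{mM + ni}` in `φ(mk g)` is `εⁱ · (gᵢ)_M`
  (`MonomialCusp.coeff_sum_expand`, p542769);
* `mk_eq_sum_monomials` — `mk g = Σ_{i<m} Σ_M (gᵢ)_M · z̄ⁱ t̄ᴹ`;
* **`cohomologyAnnihilator_eq_span_monomials`** — `ca(R) = Ideal.span {z̄ⁱ t̄ᴹ | i < m, (m−1)(n−1) ≤ n i + m M}`: `⊇` by the
  monomial criterion, `⊆` because a monomial `z̄ⁱ t̄ᴹ` with nonzero coefficient in the normal form of `r ∈ ca(R)` shows up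
  as the coefficient `εⁱ (gᵢ)_M ≠ 0` of `τ^{mM+ni}` in `φ(r)`, which `τᶜ ∣ φ(r)` forces to have `mM + ni ≥ c`;
  `cohomologyAnnihilatorOfDegree_eq_span_monomials` — the same for every `caᴺ(R)`, `N ≥ 2`.
  Instances (the CA-CURVE table, by `decide` on the exponents): `A_{2j}` `(m,n) = (2, 2j+1)`: generators `z̄, t̄ʲ`;
  `E₆ (3,4)`: `z̄², z̄t̄, t̄²`; `E₈ (3,5)`: `z̄², z̄t̄, t̄³`; `E₁₂ (3,7)`: `z̄², z̄t̄², t̄⁴`; `W₁₂ (4,5)`: `z̄³, z̄²t̄, z̄t̄², t̄³` —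
  read off from the inequality; no separate declarations.

References (mechanism only): S. B. Iyengar, R. Takahashi, IMRN 2016 §2 [`IyengarTakahashi2014`]; Ö. Esentepe,
J. Algebra 541 (2020) Thm 4.4 [`Esentepe2020`] (statement shape only).
-/

noncomputable section

-- single-problem summit: the doubled namespace component `ResolutionOfSingularities` is forced
set_option linter.dupNamespace false

namespace Summit.ResolutionOfSingularities.ResolutionOfSingularities.Theorems.HomologicalConductor.MonomialCurveIdeal

open Polynomial Literature.RingTheory.CohomologyAnnihilator
open Summit.ResolutionOfSingularities.ResolutionOfSingularities.Theorems.HomologicalConductor.MonomialCusp (coeff_sum_expand)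
open Summit.ResolutionOfSingularities.ResolutionOfSingularities.Theorems.HomologicalConductor.MonomialCurveExact

universe u

variable (k : Type u) [Field k] (ε : k) (m n : ℕ)

/-- **Normal form**: every element of `R = k[t][z]/(f)` is `mk g` with `deg_z g < m` (reduce modulo the monic `f`). [folklore] -/
theorem exists_mk_eq_of_natDegree_lt (hm : 0 < m) (r : AdjoinRoot (X ^ m - C (C (ε ^ m) * X ^ n) : Polynomial (Polynomial k))) :
    ∃ g : Polynomial (Polynomial k), g.natDegree < m ∧ AdjoinRoot.mk (X ^ m - C (C (ε ^ m) * X ^ n) : Polynomial (Polynomial k)) g = r := by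
  obtain ⟨g, rfl⟩ := AdjoinRoot.mk_surjective r
  have hfm : (X ^ m - C (C (ε ^ m) * X ^ n) : Polynomial (Polynomial k)).Monic := monic_f k ε m n hm
  have hfd : (X ^ m - C (C (ε ^ m) * X ^ n) : Polynomial (Polynomial k)).natDegree = m := by rw [Polynomial.natDegree_X_pow_sub_C]
  refine ⟨g %ₘ (X ^ m - C (C (ε ^ m) * X ^ n) : Polynomial (Polynomial k)), ?_, ?_⟩
  · by_cases h0 : g %ₘ (X ^ m - C (C (ε ^ m) * X ^ n) : Polynomial (Polynomial k)) = 0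
    · rw [h0, Polynomial.natDegree_zero]; exact hm
    · have h1 : (X ^ m - C (C (ε ^ m) * X ^ n) : Polynomial (Polynomial k)) ≠ 1 := by
        intro h1
        have := congrArg Polynomial.natDegree h1
        rw [hfd, Polynomial.natDegree_one] at this
        omega
      have := Polynomial.natDegree_modByMonic_lt g hfm h1
      rwa [hfd] at this
  · rw [AdjoinRoot.mk_eq_mk]
    refine ⟨-(g /ₘ (X ^ m - C (C (ε ^ m) * X ^ n) : Polynomial (Polynomial k))), ?_⟩
    have := Polynomial.modByMonic_add_div g (X ^ m - C (C (ε ^ m) * X ^ n) : Polynomial (Polynomial k))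
    linear_combination this

/-- **Coefficient extraction**: for `deg_z g < m`, `i < m`: the coefficient of `τ^{mM + ni}` in `φ(mk g)` is `εⁱ·(gᵢ)_M`.
[folklore] -/
theorem coeff_lift_mk (hmn : Nat.Coprime m n) (hm : 0 < m) {g : Polynomial (Polynomial k)} (hg : g.natDegree < m)
    (M : ℕ) {i : ℕ} (hi : i < m) :
    (AdjoinRoot.lift ((Polynomial.expand k m : Polynomial k →ₐ[k] Polynomial k) : Polynomial k →+* Polynomial k)
        (C ε * X ^ n) (eval₂_f_eq_zero k ε m n) (AdjoinRoot.mk (X ^ m - C (C (ε ^ m) * X ^ n) : Polynomial (Polynomial k)) g)).coeff (m * M + n * i) = ε ^ i * (g.coeff i).coeff M := by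
  rw [AdjoinRoot.lift_mk, Polynomial.eval₂_eq_sum_range' _ hg]
  simpa only [RingHom.coe_coe] using coeff_sum_expand k ε m n hmn hm (fun j => g.coeff j) M hi

/-- **Monomial expansion of the normal form**: `mk g = Σ_{i<m} Σ_{M ≤ deg gᵢ} (gᵢ)_M · z̄ⁱ t̄ᴹ`. [folklore] -/
theorem mk_eq_sum_monomials {g : Polynomial (Polynomial k)} (hg : g.natDegree < m) :
    AdjoinRoot.mk (X ^ m - C (C (ε ^ m) * X ^ n) : Polynomial (Polynomial k)) g = ∑ i ∈ Finset.range m, ∑ M ∈ Finset.range ((g.coeff i).natDegree + 1),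
      algebraMap k (AdjoinRoot (X ^ m - C (C (ε ^ m) * X ^ n) : Polynomial (Polynomial k))) ((g.coeff i).coeff M) * (AdjoinRoot.root (X ^ m - C (C (ε ^ m) * X ^ n) : Polynomial (Polynomial k)) ^ i * AdjoinRoot.of (X ^ m - C (C (ε ^ m) * X ^ n) : Polynomial (Polynomial k)) X ^ M) := by
  conv_lhs => rw [← AdjoinRoot.aeval_eq, Polynomial.aeval_eq_sum_range' hg]
  refine Finset.sum_congr rfl fun i _ => ?_
  rw [Algebra.smul_def, AdjoinRoot.algebraMap_eq]
  conv_lhs => rw [(g.coeff i).as_sum_range_C_mul_X_pow, map_sum, Finset.sum_mul]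
  refine Finset.sum_congr rfl fun M _ => ?_
  rw [map_mul (AdjoinRoot.of (X ^ m - C (C (ε ^ m) * X ^ n) : Polynomial (Polynomial k))), map_pow (AdjoinRoot.of (X ^ m - C (C (ε ^ m) * X ^ n) : Polynomial (Polynomial k))), IsScalarTower.algebraMap_apply k (Polynomial k) (AdjoinRoot (X ^ m - C (C (ε ^ m) * X ^ n) : Polynomial (Polynomial k))),
    AdjoinRoot.algebraMap_eq, Polynomial.algebraMap_eq]
  ring

/-- **THE COHOMOLOGY ANNIHILATOR OF A MONOMIAL BRANCH AS A MONOMIAL IDEAL**: for `ε ≠ 0` and coprime `m, n > 1`,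
`ca(k[t][z]/(zᵐ − εᵐtⁿ)) = (z̄ⁱ t̄ᴹ : i < m, (m−1)(n−1) ≤ n i + m M)`. [folklore] -/
theorem cohomologyAnnihilator_eq_span_monomials (hε : ε ≠ 0) (hmn : Nat.Coprime m n) (hm : 1 < m) (hn : 1 < n) :
    cohomologyAnnihilator (AdjoinRoot (X ^ m - C (C (ε ^ m) * X ^ n) : Polynomial (Polynomial k))) =
      Ideal.span {r | ∃ i M : ℕ, i < m ∧ (m - 1) * (n - 1) ≤ n * i + m * M ∧
        r = AdjoinRoot.root (X ^ m - C (C (ε ^ m) * X ^ n) : Polynomial (Polynomial k)) ^ i * AdjoinRoot.of (X ^ m - C (C (ε ^ m) * X ^ n) : Polynomial (Polynomial k)) X ^ M} := by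
  apply le_antisymm
  · intro r hr
    have hdvd := (mem_cohomologyAnnihilator_iff_X_pow_dvd k ε m n hε hmn hm hn r).mp hr
    obtain ⟨g, hg, rfl⟩ := exists_mk_eq_of_natDegree_lt k ε m n (by omega) r
    rw [mk_eq_sum_monomials k ε m n hg]
    refine Ideal.sum_mem _ fun i hi => Ideal.sum_mem _ fun M _ => ?_
    by_cases h0 : (g.coeff i).coeff M = 0
    · rw [h0, map_zero, zero_mul]; exact Ideal.zero_mem _
    · refine Ideal.mul_mem_left _ _ (Ideal.subset_span ⟨i, M, Finset.mem_range.mp hi, ?_, rfl⟩)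
      by_contra hlt
      have hcoeff := coeff_lift_mk k ε m n hmn (by omega) hg M (Finset.mem_range.mp hi)
      rw [Polynomial.X_pow_dvd_iff] at hdvd
      rw [hdvd _ (by omega)] at hcoeff
      exact h0 ((mul_eq_zero.mp hcoeff.symm).resolve_left (pow_ne_zero _ hε))
  · rw [Ideal.span_le]
    rintro r ⟨i, M, -, hiM, rfl⟩
    exact (root_pow_mul_of_X_pow_mem_cohomologyAnnihilator_iff k ε m n hε hmn hm hn M i).mpr hiM

/-- Levelled: `caᴺ(R)` is the same monomial ideal for every `N ≥ 2`. [folklore] -/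
theorem cohomologyAnnihilatorOfDegree_eq_span_monomials (hε : ε ≠ 0) (hmn : Nat.Coprime m n) (hm : 1 < m) (hn : 1 < n)
    {N : ℕ} (hN : 2 ≤ N) :
    cohomologyAnnihilatorOfDegree (AdjoinRoot (X ^ m - C (C (ε ^ m) * X ^ n) : Polynomial (Polynomial k))) N =
      Ideal.span {r | ∃ i M : ℕ, i < m ∧ (m - 1) * (n - 1) ≤ n * i + m * M ∧
        r = AdjoinRoot.root (X ^ m - C (C (ε ^ m) * X ^ n) : Polynomial (Polynomial k)) ^ i * AdjoinRoot.of (X ^ m - C (C (ε ^ m) * X ^ n) : Polynomial (Polynomial k)) X ^ M} := by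
  rw [← cohomologyAnnihilator_eq_span_monomials k ε m n hε hmn hm hn]
  apply le_antisymm (cohomologyAnnihilatorOfDegree_le N)
  intro r hr
  exact (mem_cohomologyAnnihilatorOfDegree_iff_X_pow_dvd k ε m n hε hmn hm hn hN r).mpr
    ((mem_cohomologyAnnihilator_iff_X_pow_dvd k ε m n hε hmn hm hn r).mp hr)

end Summit.ResolutionOfSingularities.ResolutionOfSingularities.Theorems.HomologicalConductor.MonomialCurveIdeal

end
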